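import Summits.NavierStokesRegularity.NavierStokesRegularity.Theorems.AxisTwistDoorAveragedConeLiouvilleNUWeakEnergyIdentity
import HarnessLib

/-!
# N4 / T1 piece W1a (continued): time integration by parts ON THE CYLINDER for the Lipschitz
# generalized supersolution (`−∫ c ∂ₜ(H∘V) Θ² = ∫ c' H(V) Θ²`)

Route `AxisTwistDoor`, crux `AveragedConeLiouville` (stmt-NavierStokesRegularity-26889), INPUT N4 / T1,
programme `kits/N4-T1-skeleton.lean` (118454bf17607d1e), brick W1a of `kits/N4-T1-W1-handoff.md`,
step 6: for the Lipschitz extension `g` of `V` (equal to `V` on the open cylinder `W`), `H ∈ C²`,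
`Θ ∈ C¹` with `tsupport Θ ⊆ B(0,ρ₀)`, `ρ₀ < 1`, and a Lipschitz time weight `c` vanishing outside
`]τ₀,T₀[` (`0 < τ₀`, `T₀ < T`):
`∫_W c ∂ₜ(H∘V) Θ² = −∫_W c' H(V) Θ²` — from `integral_timeDeriv_mul_eq_neg` applied to the globally
Lipschitz `F = H ∘ clamp ∘ g` (the clamp is inactive near the compact `[τ₀,T₀] × B̄(0,ρ₀)`) and
`G = c(t)Θ(x)²`.

WHAT THIS IS NOT: not a statement about Navier–Stokes; T1 is an INPUT; item 26889 and the summit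
stay open. [cite: NazarovUraltseva2011HarnackDivFree, §1 p. 2–3, §3 (3.2) (arXiv:1011.1888 p. 8)]
-/

noncomputable section

-- the summit and its single sub-problem share the name (CONVENTIONS §1)
set_option linter.dupNamespace false

open MeasureTheory Set Function Filter Topology Metric
open scoped NNReal ENNReal InnerProductSpace RealInnerProductSpace

namespace Summit.NavierStokesRegularity.NavierStokesRegularity.Theorems.AveragedConeLiouville.NUPositivity

/-- **Time integration by parts on the cylinder** (module docstring). [folklore] -/
theorem time_ibp_on_cylinder {T : ℝ} {V : ℝ → EuclideanSpace ℝ (Fin 3) → ℝ}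
    {g : ℝ × EuclideanSpace ℝ (Fin 3) → ℝ} {L : ℝ≥0} (hg : LipschitzWith L g)
    (hVg : EqOn (uncurry V) g (Ioo 0 T ×ˢ ball (0 : EuclideanSpace ℝ (Fin 3)) 1))
    {H : ℝ → ℝ} (hH : ContDiff ℝ 2 H)
    {Θ : EuclideanSpace ℝ (Fin 3) → ℝ} (hΘ : ContDiff ℝ 1 Θ) (hΘc : HasCompactSupport Θ) {ρ₀ : ℝ}
    (hρ₀ : ρ₀ < 1) (hΘρ : tsupport Θ ⊆ ball (0 : EuclideanSpace ℝ (Fin 3)) ρ₀)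
    {c : ℝ → ℝ} {Kc : ℝ≥0} (hc : LipschitzWith Kc c) {τ₀ T₀ : ℝ} (hτ₀ : 0 < τ₀) (hT₀ : T₀ < T)
    (hcτ : ∀ t, t ≤ τ₀ → c t = 0) (hcT : ∀ t, T₀ ≤ t → c t = 0) :
    ∫ p in Ioo 0 T ×ˢ ball (0 : EuclideanSpace ℝ (Fin 3)) 1,
        c p.1 * (deriv (fun s => H (V s p.2)) p.1 * Θ p.2 ^ 2) =
      -∫ p in Ioo 0 T ×ˢ ball (0 : EuclideanSpace ℝ (Fin 3)) 1,
        deriv c p.1 * (H (V p.1 p.2) * Θ p.2 ^ 2) := by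
  set W : Set (ℝ × EuclideanSpace ℝ (Fin 3)) := Ioo 0 T ×ˢ ball (0 : EuclideanSpace ℝ (Fin 3)) 1 with hW
  have hWopen : IsOpen W := isOpen_Ioo.prod isOpen_ball
  have hWm : MeasurableSet W := hWopen.measurableSet
  set K : Set (ℝ × EuclideanSpace ℝ (Fin 3)) := Icc τ₀ T₀ ×ˢ closedBall (0 : EuclideanSpace ℝ (Fin 3)) ρ₀
    with hK
  have hKc : IsCompact K := isCompact_Icc.prod (isCompact_closedBall _ _)
  have hKW : K ⊆ W := Set.prod_mono (fun t ht => ⟨hτ₀.trans_le ht.1, ht.2.trans_lt hT₀⟩)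
    (closedBall_subset_ball hρ₀)
  -- off `K`: either `c` vanishes near `p.1` (so `c p.1 = 0` and `deriv c p.1 = 0`) or `Θ p.2 = 0`
  have hoffK : ∀ p : ℝ × EuclideanSpace ℝ (Fin 3), p ∉ K →
      (c p.1 = 0 ∧ deriv c p.1 = 0) ∨ Θ p.2 = 0 := by
    intro p hp
    rcases not_and_or.mp (show ¬ (p.1 ∈ Icc τ₀ T₀ ∧ p.2 ∈ closedBall (0 : EuclideanSpace ℝ (Fin 3)) ρ₀)
      from fun h => hp ⟨h.1, h.2⟩) with h | h
    · left
      rcases not_and_or.mp (show ¬ (τ₀ ≤ p.1 ∧ p.1 ≤ T₀) from h) with h' | h'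
      · have hlt : p.1 < τ₀ := not_le.mp h'
        have hev : c =ᶠ[𝓝 p.1] fun _ => (0 : ℝ) := by
          filter_upwards [(isOpen_lt continuous_id continuous_const).mem_nhds hlt] with s hs
          exact hcτ s (le_of_lt hs)
        exact ⟨hcτ _ hlt.le, by rw [hev.deriv_eq, deriv_const]⟩
      · have hlt : T₀ < p.1 := not_le.mp h'
        have hev : c =ᶠ[𝓝 p.1] fun _ => (0 : ℝ) := by
          filter_upwards [(isOpen_lt continuous_const continuous_id).mem_nhds hlt] with s hs
          exact hcT s (le_of_lt hs)
        exact ⟨hcT _ hlt.le, by rw [hev.deriv_eq, deriv_const]⟩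
    · right
      exact image_eq_zero_of_notMem_tsupport fun h' => h (ball_subset_closedBall (hΘρ h'))
  -- the clamped composition `F = H ∘ clamp ∘ g`, globally Lipschitz
  obtain ⟨Mg, hMg⟩ := hKc.exists_bound_of_continuousOn (hg.continuous.continuousOn (s := K))
  set M' : ℝ := max Mg 0 + 1 with hM'
  have hM'pos : 0 < M' := by rw [hM']; positivity
  set φ : ℝ → ℝ := fun v => max (-M') (min M' v) with hφ
  have hφlip : LipschitzWith (max 0 (max 0 1)) φ :=
    (LipschitzWith.const (-M')).max ((LipschitzWith.const M').min LipschitzWith.id)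
  have hφmaps : ∀ v, φ v ∈ Icc (-M') M' := fun v =>
    ⟨le_max_left _ _, max_le (by linarith) (min_le_left _ _)⟩
  have hφid : ∀ v, |v| < M' → φ v = v := fun v hv => by
    have h1 : -M' < v := (abs_lt.mp hv).1
    have h2 : v < M' := (abs_lt.mp hv).2
    simp only [hφ, min_eq_right h2.le, max_eq_right h1.le]
  obtain ⟨KH, hKH⟩ := hH.contDiffOn.exists_lipschitzOnWith (by norm_num) (convex_Icc (-M') M')
    isCompact_Icc
  set F : ℝ × EuclideanSpace ℝ (Fin 3) → ℝ := fun p => H (φ (g p)) with hF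
  have hFlip : LipschitzWith (KH * (max 0 (max 0 1) * L)) F := by
    have h1 : LipschitzWith (max 0 (max 0 1) * L) (fun p => φ (g p)) := hφlip.comp hg
    have h2 : LipschitzOnWith (KH * (max 0 (max 0 1) * L)) (H ∘ fun p => φ (g p)) univ :=
      hKH.comp h1.lipschitzOnWith fun p _ => hφmaps (g p)
    exact lipschitzOnWith_univ.mp h2
  -- the weight `G = c(t) Θ(x)²`, Lipschitz with compact support in `K`
  have hΘ2 : ContDiff ℝ 1 fun y => Θ y ^ 2 := hΘ.pow 2
  have hΘ2c : HasCompactSupport fun y => Θ y ^ 2 := by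
    have e : (fun y => Θ y ^ 2) = fun y => Θ y * Θ y := funext fun y => pow_two _
    rw [e]; exact hΘc.mul_left
  obtain ⟨CΘ, hCΘ⟩ := ContDiff.lipschitzWith_of_hasCompactSupport hΘ2c hΘ2 one_ne_zero
  obtain ⟨BΘ, hBΘ⟩ := hΘ2c.exists_bound_of_continuous hΘ2.continuous
  have hBΘ0 : 0 ≤ BΘ := (norm_nonneg _).trans (hBΘ 0)
  obtain ⟨Bc₀, hBc₀⟩ := isCompact_Icc.exists_bound_of_continuousOn
    (hc.continuous.continuousOn (s := Icc τ₀ T₀))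
  have hBc0 : 0 ≤ max Bc₀ 0 := le_max_right _ _
  have hcb : ∀ t, |c t| ≤ max Bc₀ 0 := by
    intro t
    by_cases ht : t ∈ Icc τ₀ T₀
    · exact ((Real.norm_eq_abs _).symm.le.trans (hBc₀ t ht)).trans (le_max_left _ _)
    · have : c t = 0 := by
        rcases not_and_or.mp (show ¬ (τ₀ ≤ t ∧ t ≤ T₀) from ht) with h | h
        · exact hcτ t (le_of_lt (not_le.mp h))
        · exact hcT t (le_of_lt (not_le.mp h))
      rw [this, abs_zero]; exact hBc0
  set G : ℝ × EuclideanSpace ℝ (Fin 3) → ℝ := fun p => c p.1 * Θ p.2 ^ 2 with hG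
  have hGlip : LipschitzWith (⟨max Bc₀ 0, hBc0⟩ * (CΘ * 1) + ⟨BΘ, hBΘ0⟩ * (Kc * 1)) G := by
    refine lipschitzWith_mul_of_eq_zero_off (K := (univ : Set (ℝ × EuclideanSpace ℝ (Fin 3))))
      (hCΘ.comp LipschitzWith.prod_snd) (fun p => (Real.norm_eq_abs _).symm.le.trans (hBΘ p.2))
      (fun p hp => absurd (mem_univ p) hp) ((hc.comp LipschitzWith.prod_fst).lipschitzOnWith)
      (fun p _ => hcb p.1) hBc0 hBΘ0
  have hG0 : ∀ p, p ∉ K → G p = 0 := by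
    intro p hp
    rcases hoffK p hp with ⟨h1, -⟩ | h2
    · simp only [hG, h1, zero_mul]
    · simp only [hG, h2]; ring
  have hGc : HasCompactSupport G := HasCompactSupport.intro hKc hG0
  -- the whole-space integration by parts
  have hibp := integral_timeDeriv_mul_eq_neg hFlip hGlip hGc
  -- `∂ₜ G = c' Θ²` everywhere
  have hdG : ∀ p : ℝ × EuclideanSpace ℝ (Fin 3), deriv (fun s => G (s, p.2)) p.1 = deriv c p.1 * Θ p.2 ^ 2 :=
    fun p => by simp only [hG]; exact deriv_mul_const_field _
  -- near a point of `K` the clamp is inactive and `g = V`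
  have hFV : ∀ p ∈ K, F p = H (V p.1 p.2) := by
    intro p hp
    have h1 : |g p| < M' := by
      have := (Real.norm_eq_abs _).symm.le.trans (hMg p hp)
      rw [hM']; exact this.trans_lt (by linarith [le_max_left Mg 0])
    have h2 : g p = V p.1 p.2 := by have := hVg (hKW hp); simpa [uncurry] using this.symm
    show H (φ (g p)) = H (V p.1 p.2)
    rw [hφid _ h1, h2]
  have hdFV : ∀ p ∈ K, deriv (fun s => F (s, p.2)) p.1 = deriv (fun s => H (V s p.2)) p.1 := by
    intro p hp
    refine Filter.EventuallyEq.deriv_eq ?_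
    -- for `s` near `p.1`: `(s, p.2) ∈ W` and `|g (s,p.2)| < M'`
    have h1 : ∀ᶠ s in 𝓝 p.1, (s, p.2) ∈ W :=
      (Continuous.prodMk_left p.2).continuousAt.preimage_mem_nhds (hWopen.mem_nhds (hKW hp))
    have hlt : |g (p.1, p.2)| < M' := by
      have := (Real.norm_eq_abs _).symm.le.trans (hMg p hp)
      rw [hM']; exact this.trans_lt (by linarith [le_max_left Mg 0])
    have h2 : ∀ᶠ s in 𝓝 p.1, |g (s, p.2)| < M' := by
      have hcont : ContinuousAt (fun s => |g (s, p.2)|) p.1 :=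
        (continuous_abs.comp (hg.continuous.comp (Continuous.prodMk_left p.2))).continuousAt
      exact hcont.eventually (isOpen_Iio.mem_nhds hlt)
    filter_upwards [h1, h2] with s hs1 hs2
    have h3 : g (s, p.2) = V s p.2 := by have := hVg hs1; simpa [uncurry] using this.symm
    show H (φ (g (s, p.2))) = H (V s p.2)
    rw [hφid _ hs2, h3]
  -- assemble: both whole-space integrals are integrals over `W` of the claimed integrands
  have hL : (∫ p, deriv (fun s => F (s, p.2)) p.1 * G p) =
      ∫ p in W, c p.1 * (deriv (fun s => H (V s p.2)) p.1 * Θ p.2 ^ 2) := by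
    rw [← setIntegral_eq_integral_of_forall_compl_eq_zero (s := W) (fun p hp => by
      rw [hG0 p (fun h => hp (hKW h)), mul_zero])]
    refine setIntegral_congr_fun hWm fun p hp => ?_
    by_cases hpK : p ∈ K
    · rw [hdFV p hpK]; simp only [hG]; ring
    · rw [hG0 p hpK, mul_zero]
      rcases hoffK p hpK with ⟨h1, -⟩ | h2
      · rw [h1, zero_mul]
      · rw [h2]; ring
  have hR : (∫ p, F p * deriv (fun s => G (s, p.2)) p.1) =
      ∫ p in W, deriv c p.1 * (H (V p.1 p.2) * Θ p.2 ^ 2) := by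
    have hzero : ∀ p : ℝ × EuclideanSpace ℝ (Fin 3), p ∉ K →
        F p * deriv (fun s => G (s, p.2)) p.1 = 0 ∧ deriv c p.1 * (H (V p.1 p.2) * Θ p.2 ^ 2) = 0 := by
      intro p hp
      rw [hdG]
      rcases hoffK p hp with ⟨-, h1⟩ | h2
      · simp [h1]
      · simp [h2]
    rw [← setIntegral_eq_integral_of_forall_compl_eq_zero (s := W) (fun p hp =>
      (hzero p (fun h => hp (hKW h))).1)]
    refine setIntegral_congr_fun hWm fun p hp => ?_
    by_cases hpK : p ∈ K
    · rw [hdG, hFV p hpK]; ring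
    · rw [(hzero p hpK).1, (hzero p hpK).2]
  rw [← hL, hibp, hR]

end Summit.NavierStokesRegularity.NavierStokesRegularity.Theorems.AveragedConeLiouville.NUPositivity

end
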